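import Mathlib
import Literature.RepresentationTheory.FiniteGroups.SymmetricGroupFrobeniusFormula
import Literature.NumberTheory.DiophantineGeometry.SymmetricGroupRepsSignTwist
import Literature.NumberTheory.DiophantineGeometry.FirstRowPeeling
import Literature.Barriers.ValiantsHypothesis.GCTMatrixPoweringProp17OnlyIf

/-!
# The four Specht characters of level `≤ 1`: `(n)`, `(n-1,1)`, `(1ⁿ)`, `(2,1^{n-2})`

Helper file for the LEVEL-ONE programme on the crux `SnSubsetDichotomy.PolynomialSlack`
(stmt-MatrixMultiplication-8306). In the dissected BCGPU identity the low-dimensional Wedderburn blocks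
of `ℂ[S_n]` are indexed by the partitions with a part `≥ n - 1` or with `≥ n - 1` parts; this file
classifies them by their sorted parts and evaluates their characters:

* `sortedParts_of_exists_large_part`, `sortedParts_of_card_parts_ge` — such a partition has sorted
  parts `[n]`, `[n-1, 1]`, `replicate n 1` or `2 :: replicate (n-2) 1`;
* `spechtCharacter_of_sortedParts_eq_single` — `χ^{(n)} = 1`;
* `spechtCharacter_of_sortedParts_eq_hook` — **`χ^{(n-1,1)}(σ) = #fix(σ) - 1`** (Frobenius's
  alternating-sum formula with two variables, tree theorem `spechtCharacter_eq_sum_sign_mul_card`);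
* `spechtCharacter_of_sortedParts_eq_column`, `spechtCharacter_of_sortedParts_eq_twoColumn` —
  `χ^{(1ⁿ)} = sgn`, `χ^{(2,1^{n-2})}(σ) = sgn(σ)(#fix(σ) - 1)` (sign twist of the transpose,
  `spechtCharacter_transpose`).

References: W. Fulton, J. Harris, *Representation Theory*, GTM 129, (4.41) and Ex. 4.6
(`χ_{(d-1,1)}(g) = #fix(g) - 1`); G. James, LNM 682, 6.6 (sign twist).
-/

namespace Summit.MatrixMultiplication.MatrixMultiplication.Theorems.PolynomialSlack

open Literature.NumberTheory.DiophantineGeometry Literature.RepresentationTheory.FiniteGroups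
open Literature.RingTheory.SymmetricFunctions.SymmPoly (rho rho_apply)

-- `Summit.<Summit>.<Problem>` is the tree's mandated summit-side namespace (CONVENTIONS §2); for
-- this single-conjunct summit the two coincide, so each declaration silences `dupNamespace`.
set_option linter.dupNamespace false

/-! ## Partitions through their sorted parts -/

section Shapes

variable {d : ℕ}

/-- The parts of a partition are its sorted parts. [folklore] -/
theorem parts_eq_coe_sortedParts (μ : Nat.Partition d) : μ.parts = (μ.sortedParts : Multiset ℕ) :=
  (Multiset.sort_eq _ _).symm

/-- A partition is determined by its sorted parts. [folklore] -/
theorem eq_of_sortedParts_eq {μ ν : Nat.Partition d} (h : μ.sortedParts = ν.sortedParts) : μ = ν := by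
  ext1
  rw [parts_eq_coe_sortedParts, parts_eq_coe_sortedParts, h]

/-- If the parts are the multiset of a weakly decreasing list then that list is the sorted parts.
[folklore] -/
theorem sortedParts_eq_of_parts_eq (μ : Nat.Partition d) {L : List ℕ} (hL : L.Pairwise (· ≥ ·))
    (h : μ.parts = (L : Multiset ℕ)) : μ.sortedParts = L := by
  change μ.parts.sort (· ≥ ·) = L
  rw [h, Multiset.coe_sort]
  exact List.mergeSort_eq_self _ hL

/-- A multiset of naturals all `≥ 1` has cardinality at most its sum. [folklore] -/
theorem card_le_sum_of_one_le {s : Multiset ℕ} (h : ∀ a ∈ s, 1 ≤ a) : s.card ≤ s.sum := by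
  have := Multiset.card_nsmul_le_sum h
  simpa using this

/-- A multiset of naturals all `≥ 1` whose sum equals its cardinality is constant `1`. [folklore] -/
theorem eq_replicate_one_of_sum_eq_card {s : Multiset ℕ} (h : ∀ a ∈ s, 1 ≤ a) (hs : s.sum = s.card) :
    s = Multiset.replicate s.card 1 := by
  rw [Multiset.eq_replicate]
  refine ⟨rfl, fun b hb => ?_⟩
  by_contra hb1
  have hb2 : 2 ≤ b := by have := h b hb; omega
  obtain ⟨t, rfl⟩ := Multiset.exists_cons_of_mem hb
  rw [Multiset.sum_cons, Multiset.card_cons] at hs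
  have ht : t.card ≤ t.sum := card_le_sum_of_one_le fun a ha => h a (Multiset.mem_cons_of_mem ha)
  omega

/-- **Partitions with a part `≥ n - 1`** are `(n)` or `(n-1, 1)`. [folklore] -/
theorem sortedParts_of_exists_large_part (μ : Nat.Partition d) {a : ℕ} (ha : a ∈ μ.parts)
    (hda : d ≤ a + 1) : μ.sortedParts = [d] ∨ μ.sortedParts = [d - 1, 1] := by
  obtain ⟨t, ht⟩ := Multiset.exists_cons_of_mem ha
  have hsum : a + t.sum = d := by
    have := μ.parts_sum; rw [ht, Multiset.sum_cons] at this; exact this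
  have htpos : ∀ b ∈ t, 1 ≤ b := fun b hb => μ.parts_pos (by rw [ht]; exact Multiset.mem_cons_of_mem hb)
  have htcard : t.card ≤ t.sum := card_le_sum_of_one_le htpos
  have hts : t.sum ≤ 1 := by omega
  rcases Nat.eq_zero_or_pos t.card with h0 | hpos
  · -- `t = 0`, `μ = (d)`
    left
    have ht0 : t = 0 := Multiset.card_eq_zero.1 h0
    rw [ht0, Multiset.sum_zero] at hsum
    have had : a = d := by omega
    refine sortedParts_eq_of_parts_eq μ (List.pairwise_singleton _ _) ?_
    rw [ht, ht0, had]; rfl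
  · -- `t = {1}`, `μ = (d-1, 1)`
    right
    have hc1 : t.card = 1 := by omega
    obtain ⟨b, rfl⟩ := Multiset.card_eq_one.1 hc1
    rw [Multiset.sum_singleton] at hsum hts
    have hb : b = 1 := by
      have := htpos b (Multiset.mem_singleton_self b); omega
    subst hb
    have ha1 : 1 ≤ a := μ.parts_pos ha
    refine sortedParts_eq_of_parts_eq μ ?_ ?_
    · simp only [List.pairwise_cons, List.mem_singleton, forall_eq, List.Pairwise.nil, and_true,
        List.not_mem_nil, IsEmpty.forall_iff, implies_true]
      omega
    · rw [ht, show a = d - 1 by omega]; rfl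

/-- **Partitions with `≥ n - 1` parts** are `(1ⁿ)` or `(2, 1^{n-2})`. [folklore] -/
theorem sortedParts_of_card_parts_ge (μ : Nat.Partition d) (h : d ≤ μ.parts.card + 1) :
    μ.sortedParts = List.replicate d 1 ∨ μ.sortedParts = 2 :: List.replicate (d - 2) 1 := by
  have hpos : ∀ b ∈ μ.parts, 1 ≤ b := fun b hb => μ.parts_pos hb
  have hcs : μ.parts.card ≤ μ.parts.sum := card_le_sum_of_one_le hpos
  rw [μ.parts_sum] at hcs
  by_cases hall : ∀ b ∈ μ.parts, b = 1
  · left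
    have hrep : μ.parts = Multiset.replicate μ.parts.card 1 := Multiset.eq_replicate.2 ⟨rfl, hall⟩
    have hcard : μ.parts.card = d := by
      have := μ.parts_sum; rw [hrep, Multiset.sum_replicate, smul_eq_mul, mul_one] at this; exact this
    refine sortedParts_eq_of_parts_eq μ ?_ ?_
    · exact List.pairwise_replicate.2 (Or.inr le_rfl)
    · rw [hrep, hcard, Multiset.coe_replicate]
  · right
    push Not at hall
    obtain ⟨a, ha, ha1⟩ := hall
    have ha2 : 2 ≤ a := by have := hpos a ha; omega
    obtain ⟨t, ht⟩ := Multiset.exists_cons_of_mem ha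
    have hsum : a + t.sum = d := by
      have := μ.parts_sum; rw [ht, Multiset.sum_cons] at this; exact this
    have htpos : ∀ b ∈ t, 1 ≤ b := fun b hb => hpos b (by rw [ht]; exact Multiset.mem_cons_of_mem hb)
    have htcs : t.card ≤ t.sum := card_le_sum_of_one_le htpos
    have hcard : μ.parts.card = t.card + 1 := by rw [ht, Multiset.card_cons]
    -- `a = 2` and `t` is all ones
    have ha' : a = 2 := by omega
    subst ha'
    have hts : t.sum = t.card := by omega
    have htrep := eq_replicate_one_of_sum_eq_card htpos hts
    have htc : t.card = d - 2 := by omega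
    refine sortedParts_eq_of_parts_eq μ ?_ ?_
    · refine List.pairwise_cons.2 ⟨fun b hb => ?_, List.pairwise_replicate.2 (Or.inr le_rfl)⟩
      rw [List.eq_of_mem_replicate hb]; omega
    · rw [ht, htrep, htc, ← Multiset.cons_coe, Multiset.coe_replicate]

/-! ### The Young diagrams of the four shapes and their transposes -/

/-- Membership in the diagram of a partition with prescribed sorted parts. [folklore] -/
theorem mem_youngDiagram_of_sortedParts_eq (μ : Nat.Partition d) {L : List ℕ}
    (hL : μ.sortedParts = L) (i j : ℕ) :
    (i, j) ∈ μ.youngDiagram ↔ ∃ h : i < L.length, j < L[i] := by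
  rw [μ.mem_youngDiagram_iff]
  subst hL
  rfl

/-- The transpose of `(1ⁿ)` is `(n)` (`n ≥ 1`). [folklore] -/
theorem sortedParts_transpose_of_eq_replicate (μ : Nat.Partition d) (hd : 1 ≤ d)
    (h : μ.sortedParts = List.replicate d 1) : μ.transpose.sortedParts = [d] := by
  have hmem : ∀ i j : ℕ, (i, j) ∈ μ.youngDiagram ↔ i < d ∧ j < 1 := by
    intro i j
    rw [mem_youngDiagram_of_sortedParts_eq μ h]
    simp only [List.length_replicate, List.getElem_replicate]
    exact ⟨fun ⟨h1, h2⟩ => ⟨h1, h2⟩, fun ⟨h1, h2⟩ => ⟨h1, h2⟩⟩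
  have hcol : ∀ j, μ.youngDiagram.colLen j = if j < 1 then d else 0 := by
    intro j
    refine YoungDiagram.colLen_eq_of_forall_mem_iff fun i => ?_
    rw [hmem]
    split_ifs with hj
    · simp [hj]
    · constructor
      · rintro ⟨-, h2⟩; exact absurd h2 hj
      · intro hi; exact absurd hi (Nat.not_lt_zero _)
  have hd0 : 0 < d := hd
  have hrow0 : μ.youngDiagram.rowLen 0 = 1 :=
    YoungDiagram.rowLen_eq_of_forall_mem_iff fun j => by rw [hmem]; simp [hd0]
  rw [μ.sortedParts_transpose, YoungDiagram.rowLens, YoungDiagram.length_rowLens.symm.trans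
    (by rw [YoungDiagram.length_rowLens, YoungDiagram.colLen_transpose, hrow0] :
      μ.youngDiagram.transpose.rowLens.length = 1)]
  simp [YoungDiagram.rowLen_transpose, hcol]

/-- The transpose of `(2, 1^{n-2})` is `(n-1, 1)` (`n ≥ 3`). [folklore] -/
theorem sortedParts_transpose_of_eq_two_cons (μ : Nat.Partition d) (hd : 3 ≤ d)
    (h : μ.sortedParts = 2 :: List.replicate (d - 2) 1) : μ.transpose.sortedParts = [d - 1, 1] := by
  have hmem : ∀ i j : ℕ, (i, j) ∈ μ.youngDiagram ↔ (i = 0 ∧ j < 2) ∨ (1 ≤ i ∧ i < d - 1 ∧ j < 1) := by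
    intro i j
    rw [mem_youngDiagram_of_sortedParts_eq μ h]
    simp only [List.length_cons, List.length_replicate]
    constructor
    · rintro ⟨h1, h2⟩
      rcases Nat.eq_zero_or_pos i with rfl | hi
      · left; exact ⟨rfl, by simpa using h2⟩
      · right
        obtain ⟨k, rfl⟩ : ∃ k, i = k + 1 := ⟨i - 1, by omega⟩
        rw [List.getElem_cons_succ, List.getElem_replicate] at h2
        exact ⟨by omega, by omega, h2⟩
    · rintro (⟨rfl, h2⟩ | ⟨h1, h2, h3⟩)
      · exact ⟨by omega, by simpa using h2⟩
      · obtain ⟨k, rfl⟩ : ∃ k, i = k + 1 := ⟨i - 1, by omega⟩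
        refine ⟨by omega, ?_⟩
        rw [List.getElem_cons_succ, List.getElem_replicate]; exact h3
  have hcol : ∀ j, μ.youngDiagram.colLen j = if j = 0 then d - 1 else if j = 1 then 1 else 0 := by
    intro j
    refine YoungDiagram.colLen_eq_of_forall_mem_iff fun i => ?_
    rw [hmem]
    split_ifs with h0 h1
    · subst h0; omega
    · subst h1; omega
    · omega
  have hrow0 : μ.youngDiagram.rowLen 0 = 2 :=
    YoungDiagram.rowLen_eq_of_forall_mem_iff fun j => by rw [hmem]; omega
  rw [μ.sortedParts_transpose, YoungDiagram.rowLens, YoungDiagram.length_rowLens.symm.trans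
    (by rw [YoungDiagram.length_rowLens, YoungDiagram.colLen_transpose, hrow0] :
      μ.youngDiagram.transpose.rowLens.length = 2)]
  simp [YoungDiagram.rowLen_transpose, hcol, List.range_succ]

end Shapes

/-! ## The characters -/

section Characters

variable {n : ℕ}

/-- `χ^{(n)} ≡ 1`. [folklore] -/
theorem spechtCharacter_of_sortedParts_eq_single (μ : Nat.Partition n) (h : μ.sortedParts = [n])
    (σ : Equiv.Perm (Fin n)) : spechtCharacter ℂ μ σ = 1 := by
  have hn : n ≠ 0 := (μ.pos_of_mem_sortedParts (by rw [h]; simp)).ne'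
  have hμ : μ = Nat.Partition.indiscrete n :=
    eq_of_sortedParts_eq (h.trans (sortedParts_indiscrete hn).symm)
  rw [hμ]
  exact Literature.Barriers.ValiantsHypothesis.spechtCharacter_indiscrete σ

/-- The word with a single letter `1` at position `p`. [folklore] -/
theorem wordContent_indicator_one (p : Fin n) :
    wordContent (fun q : Fin n => if q = p then (1 : Fin 2) else 0) 1 = 1 := by
  rw [wordContent]
  have : (Finset.univ.filter fun q : Fin n => (if q = p then (1 : Fin 2) else 0) = 1) = {p} := by
    ext q
    simp only [Finset.mem_filter, Finset.mem_univ, true_and, Finset.mem_singleton]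
    split_ifs with hq <;> simp [hq]
  rw [this, Finset.card_singleton]

/-- Words in the letters `0, 1` with exactly one `1`, invariant under `σ`: they are the indicator words
of the fixed points of `σ`. [folklore] -/
theorem card_filter_words_hook (σ : Equiv.Perm (Fin n)) :
    (Finset.univ.filter fun w : Word 2 n => w ∘ ⇑σ = w ∧ wordContent w 1 = 1).card =
      (Finset.univ.filter fun p : Fin n => σ p = p).card := by
  classical
  -- the indicator word of a point
  set ind : Fin n → Word 2 n := fun p q => if q = p then 1 else 0 with hind
  have hinj : Function.Injective ind := by
    intro p p' hpp'
    have := congrFun hpp' p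
    simp only [hind, if_true] at this
    split_ifs at this with hp
    · exact hp
    · exact absurd this (by decide)
  symm
  rw [← Finset.card_image_of_injective _ hinj]
  congr 1
  ext w
  simp only [Finset.mem_image, Finset.mem_filter, Finset.mem_univ, true_and]
  constructor
  · rintro ⟨p, hp, rfl⟩
    refine ⟨?_, wordContent_indicator_one p⟩
    funext q
    simp only [Function.comp_apply, hind]
    by_cases hq : q = p
    · subst hq; rw [if_pos hp, if_pos rfl]
    · rw [if_neg hq, if_neg]
      intro h; apply hq
      rw [← hp] at h; exact σ.injective h
  · rintro ⟨hw, hc⟩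
    rw [wordContent, Finset.card_eq_one] at hc
    obtain ⟨p, hp⟩ := hc
    have hwp : ∀ q, w q = 1 ↔ q = p := fun q => by
      have := Finset.ext_iff.1 hp q
      simpa using this
    refine ⟨p, ?_, ?_⟩
    · -- `σ p` carries the letter `1`, so `σ p = p`
      have h1 : w (σ p) = 1 := by
        have := congrFun hw p; simp only [Function.comp_apply] at this; rw [this]; exact (hwp p).2 rfl
      exact (hwp _).1 h1
    · funext q
      simp only [hind]
      by_cases hq : q = p
      · rw [if_pos hq]; exact ((hwp q).2 hq).symm
      · rw [if_neg hq]
        have : w q ≠ 1 := fun h => hq ((hwp q).1 h)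
        exact ((by decide : ∀ x : Fin 2, x ≠ 1 → x = 0) _ this).symm

/-- Words in the letters `0, 1` with no `1`: only the constant word `0` (it is `σ`-invariant).
[folklore] -/
theorem card_filter_words_row (σ : Equiv.Perm (Fin n)) :
    (Finset.univ.filter fun w : Word 2 n => w ∘ ⇑σ = w ∧ wordContent w 1 = 0).card = 1 := by
  rw [Finset.card_eq_one]
  refine ⟨fun _ => 0, ?_⟩
  ext w
  simp only [Finset.mem_filter, Finset.mem_univ, true_and, Finset.mem_singleton]
  constructor
  · rintro ⟨-, hc⟩
    rw [wordContent, Finset.card_eq_zero, Finset.filter_eq_empty_iff] at hc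
    funext q
    exact (by decide : ∀ x : Fin 2, x ≠ 1 → x = 0) _ (hc (Finset.mem_univ q))
  · rintro rfl
    refine ⟨rfl, ?_⟩
    rw [wordContent, Finset.card_eq_zero, Finset.filter_eq_empty_iff]
    intro q _; decide

/-- The two contents of a word in the letters `0, 1` add up to its length. [folklore] -/
theorem wordContent_zero_add_one (w : Word 2 n) : wordContent w 0 + wordContent w 1 = n := by
  have := sum_wordContent w
  rwa [Fin.sum_univ_two] at this

/-- **`χ^{(n-1,1)}(σ) = #fix(σ) - 1`** (Frobenius's formula with two variables: the term `τ = 1`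
counts the `σ`-invariant words of content `(n-1, 1)`, i.e. the fixed points of `σ`, and `τ = (0 1)`
counts, with sign `-1`, the single word of content `(n, 0)`). [folklore] -/
theorem spechtCharacter_of_sortedParts_eq_hook (μ : Nat.Partition n) (hn : 2 ≤ n)
    (h : μ.sortedParts = [n - 1, 1]) (σ : Equiv.Perm (Fin n)) :
    spechtCharacter ℂ μ σ = ((Finset.univ.filter fun p : Fin n => σ p = p).card : ℂ) - 1 := by
  classical
  have hN : μ.parts.card ≤ 2 := by
    rw [← μ.length_sortedParts, h]; simp
  -- the two elements of `S_2` (cf. `Literature.Geometry.Kaehler.Zucker.univ_perm_fin_two`)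
  have huniv : (Finset.univ : Finset (Equiv.Perm (Fin 2))) = {1, Equiv.swap 0 1} := by decide
  rw [spechtCharacter_eq_sum_sign_mul_card μ hN σ, huniv,
    Finset.sum_insert (by decide), Finset.sum_singleton]
  -- the conditions for `τ = 1` and `τ = (0 1)`
  have hrho0 : rho 2 0 = 1 := by rw [rho_apply]; rfl
  have hrho1 : rho 2 1 = 0 := by rw [rho_apply]; rfl
  have hcond1 : ∀ w : Word 2 n,
      (w ∘ ⇑σ = w ∧ ∀ j : Fin 2, rho 2 ((1 : Equiv.Perm (Fin 2))⁻¹ j) + wordContent w j =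
        μ.sortedParts.getD (j : ℕ) 0 + rho 2 j) ↔ (w ∘ ⇑σ = w ∧ wordContent w 1 = 1) := by
    intro w
    rw [h]
    simp only [inv_one, Equiv.Perm.coe_one, id_eq, Fin.forall_fin_two, Fin.isValue, Fin.val_zero,
      List.getD_cons_zero, Fin.val_one, List.getD_cons_succ, hrho0, hrho1]
    have := wordContent_zero_add_one w
    constructor
    · rintro ⟨hw, -, h1⟩; exact ⟨hw, by omega⟩
    · rintro ⟨hw, h1⟩; exact ⟨hw, by omega, by omega⟩
  have hcond2 : ∀ w : Word 2 n,
      (w ∘ ⇑σ = w ∧ ∀ j : Fin 2, rho 2 ((Equiv.swap (0 : Fin 2) 1)⁻¹ j) + wordContent w j =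
        μ.sortedParts.getD (j : ℕ) 0 + rho 2 j) ↔ (w ∘ ⇑σ = w ∧ wordContent w 1 = 0) := by
    intro w
    rw [h]
    simp only [Equiv.swap_inv, Fin.forall_fin_two, Fin.isValue, Equiv.swap_apply_left,
      Equiv.swap_apply_right, Fin.val_zero, List.getD_cons_zero, Fin.val_one, List.getD_cons_succ,
      hrho0, hrho1]
    have := wordContent_zero_add_one w
    constructor
    · rintro ⟨hw, -, h1⟩; exact ⟨hw, by omega⟩
    · rintro ⟨hw, h1⟩; exact ⟨hw, by omega, by omega⟩
  rw [Finset.filter_congr fun w _ => hcond1 w, Finset.filter_congr fun w _ => hcond2 w,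
    card_filter_words_hook σ, card_filter_words_row σ, Equiv.Perm.sign_one,
    Equiv.Perm.sign_swap (by decide)]
  push_cast
  ring

/-- **`χ^{(1ⁿ)} = sgn`** (`n ≥ 1`). [folklore] -/
theorem spechtCharacter_of_sortedParts_eq_column (μ : Nat.Partition n) (hn : 1 ≤ n)
    (h : μ.sortedParts = List.replicate n 1) (σ : Equiv.Perm (Fin n)) :
    spechtCharacter ℂ μ σ = ((Equiv.Perm.sign σ : ℤ) : ℂ) := by
  have ht := sortedParts_transpose_of_eq_replicate μ hn h
  rw [← μ.transpose_transpose, spechtCharacter_transpose,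
    spechtCharacter_of_sortedParts_eq_single μ.transpose ht σ, mul_one]

/-- **`χ^{(2,1^{n-2})}(σ) = sgn(σ)·(#fix(σ) - 1)`** (`n ≥ 3`). [folklore] -/
theorem spechtCharacter_of_sortedParts_eq_twoColumn (μ : Nat.Partition n) (hn : 3 ≤ n)
    (h : μ.sortedParts = 2 :: List.replicate (n - 2) 1) (σ : Equiv.Perm (Fin n)) :
    spechtCharacter ℂ μ σ =
      ((Equiv.Perm.sign σ : ℤ) : ℂ) * (((Finset.univ.filter fun p : Fin n => σ p = p).card : ℂ) - 1) := by
  have ht := sortedParts_transpose_of_eq_two_cons μ hn h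
  rw [← μ.transpose_transpose, spechtCharacter_transpose,
    spechtCharacter_of_sortedParts_eq_hook μ.transpose (by omega) ht σ]

end Characters

end Summit.MatrixMultiplication.MatrixMultiplication.Theorems.PolynomialSlack
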